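import Literature.MathematicalPhysics.QuantumLattice.HubbardTTPrimeMeanEnergySupergradient
import HarnessLib

/-!
# Convex combinations of `t–t'` window certificates: corner certificates of a box in `(t', U)`
# certify every point of the box (the "box certificate" of the Hubbard fast layer)

Family `hubbard` (topic `MathematicalPhysics/QuantumLattice`); written for the certified fast layer of
the Hubbard re-charter (crew hubbard-fast: planner-p1 TARGET §3.4′ / T4-SPEC, engine rung R0b "vertex
rule", run-book §1.3). The window (reduce- or correlator-mode) certificates of the many-body bootstrap
(Han 2020 §2–3; Wang et al. 2024 §III) for the `t–t'–U` Hubbard model are identities in the CAR algebra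
of a finite window `Λ'` whose soundness for torus-limit ground states is the tree theorem
`InfVolFermionState.IsTorusLimitOf.re_sum_expect_d4_ge_of_window_certificate_TT'_ineq`
(`HubbardNNNHoppingTorusLimitCorrelator`). The `t–t'–U` interaction is LINEAR in the coupling vector
(`hubbardTTPrimeFermionInteraction_add/_smul`, file `HubbardTTPrimeMeanEnergySupergradient`), hence so
are its local Hamiltonians and its mean-energy observable
(`FermionInteraction.localHamiltonian_of_sum`, `…meanEnergyObs_of_sum`,
`hubbardTTPrimeFermionInteraction_convexComb`). Consequently, certificates issued at finitely many
CORNERS `(t'ᵢ, Uᵢ)` which share the objective `X`, the energy multiplier `κ`, the Gram basis `O`, the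
equation-of-motion family `B`, the symmetry data and the word lists — the rows whose operators depend
on `(t', U)` — and whose remaining data (`cᵢ, uᵢ, μᵢ`, Gram matrices `Λmᵢ ⪰ 0`, `Yᵢ, bᵢ, dcᵢ, aᵢ`) are
free, COMBINE under any convex weights `wᵢ ≥ 0`, `Σ wᵢ = 1` into a certificate of the same shape at the
barycentre `(Σ wᵢ t'ᵢ, Σ wᵢ Uᵢ)` with averaged data (`sum_smul_windowCertificate_TT'`); one application of
the tree theorem there gives, for every torus-limit ground state `ω` at the barycentre and every
`energyDensityTT' t (Σ w t') (Σ w U) n ≤ Σ wᵢ uᵢ` (ONE energy hypothesis at the target — in use the `uᵢ`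
are the corner values of an affine upper majorant, so the right-hand side is that majorant at the target):

  `Σ wᵢ cᵢ − Σₖ ‖Σᵢ wᵢ aᵢₖ‖ + (Σ_σ Σᵢ wᵢ μᵢσ)(n/2 − ν) ≤ |S|⁻¹ Σ_{γ∈S} Re ω_{γΛ'}(Γ(d4Emb γ 0) X)`

(`IsTorusLimitOf.re_sum_expect_d4_ge_of_window_certificates_convexComb_TT'_ineq`; translation-only
form `…re_expect_ge_of_window_certificates_convexComb_TT'_ineq`; weighted-corner-bound corollary
`…_convexComb_TT'_ineq_weighted` by `‖Σ w a‖ ≤ Σ w ‖a‖`; `…_at` / `…_weighted_at` take a prescribed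
target `(t', U')` with the barycentre identities as hypotheses). Everything is PROVED; no definition, no
named fact, no numerical input. Why the sharing pattern is forced: the eom rows `[H_{Λ'}(t',U), B]` and
the energy row `κ(u − E_{Φ(t,t',U)})` carry the couplings inside the OPERATOR, so only corner rows
with the same `B`, `κ` average to a row at the barycentre; every coupling-independent row averages
freely (planner-p1 TARGET §3.4′, referee protocol B2).

## References

* X. Han, *Quantum many-body bootstrap*, arXiv:2006.06002 (2020), §2–§3. [cite: Han2020Bootstrap, §3]
* J. Wang et al., *Certifying ground-state properties of many-body systems*, PRX 14 (2024) 031006,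
  §III (observable bounds under an energy constraint). [cite: WangEtAl2024, §III]
* O. Bratteli, A. Kishimoto, D. W. Robinson, CMP 64 (1978) 41, §3 (mean energy is linear in the
  interaction). [cite: BratteliKishimotoRobinson1978, §3 (mean energy functional)]
-/

noncomputable section

namespace Literature.MathematicalPhysics.QuantumLattice

open Matrix Finset HubbardWave0 Literature.Probability.LatticeModels ThermodynamicLimit
open Literature.MathematicalPhysics.QuantumManyBody.StateRelaxation
open _root_.Filter
open scoped _root_.Topology ComplexOrder BigOperators

/-! ### §1 Finite linear combinations of the `t–t'–U` interaction -/

/-- The zero coupling vector gives the zero interaction. [cite: XuEtAl2024, eq. (1)] -/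
theorem hubbardTTPrimeFermionInteraction_zero (X : Finset (Site 2)) :
    (hubbardTTPrimeFermionInteraction 0 0 0).Φ X = 0 := by
  have h := hubbardTTPrimeFermionInteraction_smul 0 0 0 0 X
  rwa [mul_zero, Complex.ofReal_zero, zero_smul] at h

/-- **Additivity over finite sums of coupling vectors.** [cite: XuEtAl2024, eq. (1)] -/
theorem hubbardTTPrimeFermionInteraction_sum {ι : Type*} (S : Finset ι) (α β γ : ι → ℝ)
    (X : Finset (Site 2)) :
    (hubbardTTPrimeFermionInteraction (∑ i ∈ S, α i) (∑ i ∈ S, β i) (∑ i ∈ S, γ i)).Φ X =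
      ∑ i ∈ S, (hubbardTTPrimeFermionInteraction (α i) (β i) (γ i)).Φ X := by
  classical
  induction S using Finset.induction_on with
  | empty => simp only [Finset.sum_empty, hubbardTTPrimeFermionInteraction_zero]
  | insert a s ha ih =>
    rw [Finset.sum_insert ha, Finset.sum_insert ha, Finset.sum_insert ha, Finset.sum_insert ha,
      hubbardTTPrimeFermionInteraction_add, ih]

/-- **Convex (indeed any affine-with-unit-total-weight) combination at fixed `t`**: for weights with
`Σ wᵢ = 1`, `Φ(t, Σ wᵢ t'ᵢ, Σ wᵢ Uᵢ) X = Σ wᵢ • Φ(t, t'ᵢ, Uᵢ) X`. [cite: XuEtAl2024, eq. (1)] -/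
theorem hubbardTTPrimeFermionInteraction_convexComb {ι : Type*} (S : Finset ι) (w : ι → ℝ)
    (hw1 : ∑ i ∈ S, w i = 1) (t : ℝ) (tp U : ι → ℝ) (X : Finset (Site 2)) :
    (hubbardTTPrimeFermionInteraction t (∑ i ∈ S, w i * tp i) (∑ i ∈ S, w i * U i)).Φ X =
      ∑ i ∈ S, ((w i : ℝ) : ℂ) • (hubbardTTPrimeFermionInteraction t (tp i) (U i)).Φ X := by
  have ht : t = ∑ i ∈ S, w i * t := by rw [← Finset.sum_mul, hw1, one_mul]
  conv_lhs => rw [ht]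
  rw [hubbardTTPrimeFermionInteraction_sum]
  exact Finset.sum_congr rfl fun i _ => hubbardTTPrimeFermionInteraction_smul (w i) t (tp i) (U i) X

namespace FermionInteraction

variable {d : ℕ}

/-- The local Hamiltonians of a pointwise finite linear combination of interactions.
[cite: ArakiMoriya2003, §5.1 (local Hamiltonian H(I))] -/
theorem localHamiltonian_of_sum {ι : Type*} {S : Finset ι} {c : ι → ℂ}
    {Ψ : FermionInteraction d} {Ψi : ι → FermionInteraction d}
    (h : ∀ X, Ψ.Φ X = ∑ i ∈ S, c i • (Ψi i).Φ X) (Λ : Finset (Site d)) :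
    Ψ.localHamiltonian Λ = ∑ i ∈ S, c i • (Ψi i).localHamiltonian Λ := by
  unfold localHamiltonian
  simp_rw [Finset.smul_sum]
  rw [Finset.sum_comm]
  refine Finset.sum_congr rfl fun X _ => ?_
  rw [h, map_sum]
  exact Finset.sum_congr rfl fun i _ => by rw [map_smul]

/-- The mean-energy observable of a pointwise finite linear combination of interactions.
[cite: BratteliKishimotoRobinson1978, §3 (mean energy functional)] -/
theorem meanEnergyObs_of_sum {ι : Type*} {S : Finset ι} {c : ι → ℂ}
    {Ψ : FermionInteraction d} {Ψi : ι → FermionInteraction d}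
    (h : ∀ X, Ψ.Φ X = ∑ i ∈ S, c i • (Ψi i).Φ X) (R : ℝ) :
    Ψ.meanEnergyObs R = ∑ i ∈ S, c i • (Ψi i).meanEnergyObs R := by
  unfold meanEnergyObs
  simp_rw [Finset.smul_sum]
  rw [Finset.sum_comm]
  refine Finset.sum_congr rfl fun X _ => ?_
  rw [h, map_sum, Finset.smul_sum]
  exact Finset.sum_congr rfl fun i _ => by rw [map_smul, smul_comm]

end FermionInteraction

/-- Gram elements are linear in the Gram matrix: finite linear combinations. [cite: Han2020Bootstrap, §2 eq. (3)] -/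
theorem gramForm_sum_smul {𝓐 : Type*} [Ring 𝓐] [StarRing 𝓐] [Algebra ℂ 𝓐] {m : Type*} [Fintype m]
    {ι : Type*} (S : Finset ι) (c : ι → ℂ) (Λm : ι → Matrix m m ℂ) (O : m → 𝓐) :
    gramForm (∑ i ∈ S, c i • Λm i) O = ∑ i ∈ S, c i • gramForm (Λm i) O := by
  unfold gramForm
  have hL : ∀ a b : m, (∑ i ∈ S, c i • Λm i) a b • (star (O a) * O b) =
      ∑ i ∈ S, c i • (Λm i a b • (star (O a) * O b)) := by
    intro a b
    rw [Matrix.sum_apply, Finset.sum_smul]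
    exact Finset.sum_congr rfl fun i _ => by rw [Matrix.smul_apply, smul_eq_mul, mul_smul]
  have hR : ∀ i : ι, c i • ∑ a : m, ∑ b : m, Λm i a b • (star (O a) * O b) =
      ∑ a : m, ∑ b : m, c i • (Λm i a b • (star (O a) * O b)) := by
    intro i
    rw [Finset.smul_sum]
    exact Finset.sum_congr rfl fun a _ => Finset.smul_sum
  simp_rw [hL, hR]
  symm
  rw [Finset.sum_comm]
  refine Finset.sum_congr rfl fun a _ => ?_
  rw [Finset.sum_comm]


/-! ### §2 The convex combination of corner certificates -/

/-- **Box certificate (point-group-reduced form).** Corner certificates at `(t'ᵢ, Uᵢ)`, `i ∈ I`,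
sharing `X`, `κ`, `ν`, the Gram basis `O`, the eom family `B`, the symmetry data `(γ, wv)` and the
word lists, with free `cᵢ, uᵢ, μᵢ, Λmᵢ ⪰ 0, Yᵢ, bᵢ, dcᵢ, aᵢ`, and convex weights `wᵢ ≥ 0`, `Σ wᵢ = 1`:
for every torus-limit ground state `ω` at the barycentre `(Σ wᵢ t'ᵢ, Σ wᵢ Uᵢ)` (torus limit along
`Ls → ∞` of unit `(rectN n (Ls j), S^z = 0)` sector ground states) and the single energy hypothesis
`e(t, Σ w t', Σ w U, n) ≤ Σ wᵢ uᵢ`,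
`Σ wᵢ cᵢ − Σₖ ‖Σᵢ wᵢ aᵢₖ‖ + (Σ_σ Σᵢ wᵢ μᵢσ)(n/2 − ν) ≤ |S|⁻¹ Σ_{γ∈S} Re ω_{γΛ'}(Γ(d4Emb γ 0) X)`.
[cite: WangEtAl2024, §III] -/
theorem InfVolFermionState.IsTorusLimitOf.re_sum_expect_d4_ge_of_window_certificates_convexComb_TT'_ineq
    (t : ℝ) {ι₀ : Type*} (I : Finset ι₀) (w : ι₀ → ℝ) (hw0 : ∀ i ∈ I, 0 ≤ w i)
    (hw1 : ∑ i ∈ I, w i = 1) (tp U u c : ι₀ → ℝ) (hU : ∀ i ∈ I, 0 ≤ U i)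
    {n : ℝ} (hn0 : 0 ≤ n) (hn2 : n < 2) {κ : ℝ} (hκ : 0 ≤ κ)
    (hu : ThermodynamicLimit.energyDensityTT' t (∑ i ∈ I, w i * tp i) (∑ i ∈ I, w i * U i) n ≤
      ∑ i ∈ I, w i * u i)
    {Λ Λ' : Finset (Site 2)} (hΛ : Λ ⊆ Λ') (h8 : thicken Λ 1 ⊆ Λ')
    (h0 : thicken ({0} : Finset (Site 2)) 1 ⊆ Λ') (hz : (0 : Site 2) ∈ Λ')
    {S : Finset (DihedralGroup 4)} (h1 : (1 : DihedralGroup 4) ∈ S) (hmul : ∀ a ∈ S, ∀ b ∈ S, a * b ∈ S)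
    (Xw : FermionOp Λ') (μ : ι₀ → Fin 2 → ℝ) (ν : ℝ)
    {m : Type*} [Fintype m] [DecidableEq m] (Λm : ι₀ → Matrix m m ℂ)
    (hΛm : ∀ i ∈ I, (Λm i).PosSemidef) (O : m → FermionOp Λ')
    {κ' : Type*} (s : Finset κ') (B : κ' → FermionOp Λ)
    {ι : Type*} (tt : Finset ι) (γ : ι → DihedralGroup 4) (hγS : ∀ l ∈ tt, γ l ∈ S) (wv : ι → Site 2)
    (hsh : ∀ l, d4ShiftSet (γ l) (wv l) Λ ⊆ Λ') (Y : ι₀ → ι → FermionOp Λ)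
    {ρ : Type*} (uu : Finset ρ) (b : ι₀ → ρ → ℂ) (cw : ρ → List (Orb (PolySite Λ') × Bool))
    (hcw : ∀ j ∈ uu, ladderCharge (cw j) ≠ 0 ∨ ladderSpinCharge (cw j) ≠ 0)
    {δ : Type*} (ah : Finset δ) (dc : ι₀ → δ → ℝ) (V : δ → FermionOp Λ')
    {κ'' : Type*} (wd : Finset κ'') (a : ι₀ → κ'' → ℂ)
    (word : κ'' → List (Orb (PolySite Λ') × Bool))
    (hcert : ∀ i ∈ I, Xw - ((c i : ℝ) : ℂ) • (1 : FermionOp Λ') -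
        ∑ σ : Fin 2, ((μ i σ : ℝ) : ℂ) • (nAt 0 hz σ - ((ν : ℝ) : ℂ) • (1 : FermionOp Λ')) -
        ((κ : ℝ) : ℂ) • (((u i : ℝ) : ℂ) • (1 : FermionOp Λ') -
          fermionEmbed (PolySite.incl h0)
            ((hubbardTTPrimeFermionInteraction t (tp i) (U i)).meanEnergyObs 1)) =
      gramForm (Λm i) O +
        (∑ k ∈ s, ((hubbardTTPrimeFermionInteraction t (tp i) (U i)).localHamiltonian Λ' *
              fermionEmbed (PolySite.incl hΛ) (B k) -
            fermionEmbed (PolySite.incl hΛ) (B k) *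
              (hubbardTTPrimeFermionInteraction t (tp i) (U i)).localHamiltonian Λ') +
          ∑ l ∈ tt, (fermionEmbed (PolySite.incl (hsh l))
              (fermionEmbed (PolySite.d4Emb (γ l) (wv l) Λ) (Y i l)) -
            fermionEmbed (PolySite.incl hΛ) (Y i l)) +
          ∑ j ∈ uu, b i j • ladderWord (cw j)) +
        (∑ m' ∈ ah, ((dc i m' : ℝ) : ℂ) • ((V m')ᴴ - V m') + ∑ k ∈ wd, a i k • ladderWord (word k)))
    {Ls : ℕ → ℕ} (hLs : Tendsto Ls atTop atTop)
    {ψ : ∀ L, Fock (Orb (FermionTorus 2 L))}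
    (hψ : ∀ j, IsGroundStateInSector
      (hubbardTorusTT' (Ls j) t (∑ i ∈ I, w i * tp i) (∑ i ∈ I, w i * U i))
      (ThermodynamicLimit.rectN n (Ls j)) 0 (ψ (Ls j)))
    (hψ1 : ∀ j, star (ψ (Ls j)) ⬝ᵥ ψ (Ls j) = 1)
    {ω : InfVolFermionState 2} (hω : ω.IsTorusLimitOf ψ Ls) :
    ∑ i ∈ I, w i * c i - ∑ k ∈ wd, ‖∑ i ∈ I, ((w i : ℝ) : ℂ) * a i k‖ +
        (∑ σ : Fin 2, ∑ i ∈ I, w i * μ i σ) * (n / 2 - ν) ≤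
      (S.card : ℝ)⁻¹ * ∑ g ∈ S,
        (ω.expect (d4ShiftSet g 0 Λ') (fermionEmbed (PolySite.d4Emb g 0 Λ') Xw)).re := by
  -- the interaction at the barycentre is the weighted sum of the corner interactions
  have hUbar : 0 ≤ ∑ i ∈ I, w i * U i :=
    Finset.sum_nonneg fun i hi => mul_nonneg (hw0 i hi) (hU i hi)
  have hΦ : ∀ X, (hubbardTTPrimeFermionInteraction t (∑ i ∈ I, w i * tp i) (∑ i ∈ I, w i * U i)).Φ X =
      ∑ i ∈ I, ((w i : ℝ) : ℂ) • (hubbardTTPrimeFermionInteraction t (tp i) (U i)).Φ X := fun X =>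
    hubbardTTPrimeFermionInteraction_convexComb I w hw1 t tp U X
  have hH := FermionInteraction.localHamiltonian_of_sum hΦ Λ'
  have hE := FermionInteraction.meanEnergyObs_of_sum hΦ 1
  -- shorthand for the corner and barycentre objects
  set Φb := hubbardTTPrimeFermionInteraction t (∑ i ∈ I, w i * tp i) (∑ i ∈ I, w i * U i) with hΦb
  set Hi : ι₀ → FermionOp Λ' := fun i =>
    (hubbardTTPrimeFermionInteraction t (tp i) (U i)).localHamiltonian Λ' with hHi
  set Ei : ι₀ → FermionOp (thicken ({0} : Finset (Site 2)) 1) := fun i =>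
    (hubbardTTPrimeFermionInteraction t (tp i) (U i)).meanEnergyObs 1 with hEi
  have hH' : Φb.localHamiltonian Λ' = ∑ i ∈ I, ((w i : ℝ) : ℂ) • Hi i := hH
  have hE' : Φb.meanEnergyObs 1 = ∑ i ∈ I, ((w i : ℝ) : ℂ) • Ei i := hE
  -- averaged data
  have hΛbar : (∑ i ∈ I, ((w i : ℝ) : ℂ) • Λm i).PosSemidef :=
    Matrix.posSemidef_sum I fun i hi => (hΛm i hi).smul (Complex.zero_le_real.2 (hw0 i hi))
  have hw1C : ∑ i ∈ I, ((w i : ℝ) : ℂ) = 1 := by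
    rw [← Complex.ofReal_sum, hw1, Complex.ofReal_one]
  -- §A the left-hand sides combine
  have hl : ∑ i ∈ I, ((w i : ℝ) : ℂ) • (Xw - ((c i : ℝ) : ℂ) • (1 : FermionOp Λ') -
        ∑ σ : Fin 2, ((μ i σ : ℝ) : ℂ) • (nAt 0 hz σ - ((ν : ℝ) : ℂ) • (1 : FermionOp Λ')) -
        ((κ : ℝ) : ℂ) • (((u i : ℝ) : ℂ) • (1 : FermionOp Λ') - fermionEmbed (PolySite.incl h0) (Ei i))) =
      Xw - (((∑ i ∈ I, w i * c i : ℝ)) : ℂ) • (1 : FermionOp Λ') -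
        ∑ σ : Fin 2, (((∑ i ∈ I, w i * μ i σ : ℝ)) : ℂ) • (nAt 0 hz σ - ((ν : ℝ) : ℂ) • (1 : FermionOp Λ')) -
        ((κ : ℝ) : ℂ) • ((((∑ i ∈ I, w i * u i : ℝ)) : ℂ) • (1 : FermionOp Λ') -
          fermionEmbed (PolySite.incl h0) (Φb.meanEnergyObs 1)) := by
    have P1 : ∑ i ∈ I, ((w i : ℝ) : ℂ) • Xw = Xw := by
      rw [← Finset.sum_smul, hw1C, one_smul]
    have P2 : ∑ i ∈ I, ((w i : ℝ) : ℂ) • (((c i : ℝ) : ℂ) • (1 : FermionOp Λ')) =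
        (((∑ i ∈ I, w i * c i : ℝ)) : ℂ) • (1 : FermionOp Λ') := by
      simp_rw [smul_smul]
      rw [← Finset.sum_smul, Complex.ofReal_sum]
      simp_rw [Complex.ofReal_mul]
    have P3 : ∑ i ∈ I, ((w i : ℝ) : ℂ) •
          ∑ σ : Fin 2, ((μ i σ : ℝ) : ℂ) • (nAt 0 hz σ - ((ν : ℝ) : ℂ) • (1 : FermionOp Λ')) =
        ∑ σ : Fin 2, (((∑ i ∈ I, w i * μ i σ : ℝ)) : ℂ) •
          (nAt 0 hz σ - ((ν : ℝ) : ℂ) • (1 : FermionOp Λ')) := by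
      simp_rw [Finset.smul_sum, smul_smul]
      rw [Finset.sum_comm]
      refine Finset.sum_congr rfl fun σ _ => ?_
      rw [← Finset.sum_smul, Complex.ofReal_sum]
      simp_rw [Complex.ofReal_mul]
    have P4 : ∑ i ∈ I, ((w i : ℝ) : ℂ) • (((κ : ℝ) : ℂ) •
          (((u i : ℝ) : ℂ) • (1 : FermionOp Λ') - fermionEmbed (PolySite.incl h0) (Ei i))) =
        ((κ : ℝ) : ℂ) • ((((∑ i ∈ I, w i * u i : ℝ)) : ℂ) • (1 : FermionOp Λ') -
          fermionEmbed (PolySite.incl h0) (Φb.meanEnergyObs 1)) := by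
      simp_rw [smul_comm ((w _ : ℝ) : ℂ) ((κ : ℝ) : ℂ)]
      rw [← Finset.smul_sum]
      congr 1
      simp_rw [smul_sub]
      rw [Finset.sum_sub_distrib]
      congr 1
      · simp_rw [smul_smul]
        rw [← Finset.sum_smul, Complex.ofReal_sum]
        simp_rw [Complex.ofReal_mul]
      · rw [hE', map_sum]
        exact Finset.sum_congr rfl fun i _ => by rw [map_smul]
    have hdist : ∀ i ∈ I, ((w i : ℝ) : ℂ) • (Xw - ((c i : ℝ) : ℂ) • (1 : FermionOp Λ') -
          ∑ σ : Fin 2, ((μ i σ : ℝ) : ℂ) • (nAt 0 hz σ - ((ν : ℝ) : ℂ) • (1 : FermionOp Λ')) -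
          ((κ : ℝ) : ℂ) • (((u i : ℝ) : ℂ) • (1 : FermionOp Λ') - fermionEmbed (PolySite.incl h0) (Ei i))) =
        ((w i : ℝ) : ℂ) • Xw - ((w i : ℝ) : ℂ) • (((c i : ℝ) : ℂ) • (1 : FermionOp Λ')) -
          ((w i : ℝ) : ℂ) • ∑ σ : Fin 2, ((μ i σ : ℝ) : ℂ) • (nAt 0 hz σ - ((ν : ℝ) : ℂ) • (1 : FermionOp Λ')) -
          ((w i : ℝ) : ℂ) • (((κ : ℝ) : ℂ) •
            (((u i : ℝ) : ℂ) • (1 : FermionOp Λ') - fermionEmbed (PolySite.incl h0) (Ei i))) := by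
      intro i _
      rw [smul_sub, smul_sub, smul_sub]
    rw [Finset.sum_congr rfl hdist, Finset.sum_sub_distrib, Finset.sum_sub_distrib,
      Finset.sum_sub_distrib, P1, P2, P3, P4]
  -- §B the right-hand sides combine
  have hr : ∑ i ∈ I, ((w i : ℝ) : ℂ) • (gramForm (Λm i) O +
        (∑ k ∈ s, (Hi i * fermionEmbed (PolySite.incl hΛ) (B k) -
            fermionEmbed (PolySite.incl hΛ) (B k) * Hi i) +
          ∑ l ∈ tt, (fermionEmbed (PolySite.incl (hsh l))
              (fermionEmbed (PolySite.d4Emb (γ l) (wv l) Λ) (Y i l)) -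
            fermionEmbed (PolySite.incl hΛ) (Y i l)) +
          ∑ j ∈ uu, b i j • ladderWord (cw j)) +
        (∑ m' ∈ ah, ((dc i m' : ℝ) : ℂ) • ((V m')ᴴ - V m') + ∑ k ∈ wd, a i k • ladderWord (word k))) =
      gramForm (∑ i ∈ I, ((w i : ℝ) : ℂ) • Λm i) O +
        (∑ k ∈ s, (Φb.localHamiltonian Λ' * fermionEmbed (PolySite.incl hΛ) (B k) -
            fermionEmbed (PolySite.incl hΛ) (B k) * Φb.localHamiltonian Λ') +
          ∑ l ∈ tt, (fermionEmbed (PolySite.incl (hsh l))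
              (fermionEmbed (PolySite.d4Emb (γ l) (wv l) Λ) (∑ i ∈ I, ((w i : ℝ) : ℂ) • Y i l)) -
            fermionEmbed (PolySite.incl hΛ) (∑ i ∈ I, ((w i : ℝ) : ℂ) • Y i l)) +
          ∑ j ∈ uu, (∑ i ∈ I, ((w i : ℝ) : ℂ) * b i j) • ladderWord (cw j)) +
        (∑ m' ∈ ah, (((∑ i ∈ I, w i * dc i m' : ℝ)) : ℂ) • ((V m')ᴴ - V m') +
          ∑ k ∈ wd, (∑ i ∈ I, ((w i : ℝ) : ℂ) * a i k) • ladderWord (word k)) := by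
    have Q1 : ∑ i ∈ I, ((w i : ℝ) : ℂ) • gramForm (Λm i) O =
        gramForm (∑ i ∈ I, ((w i : ℝ) : ℂ) • Λm i) O := (gramForm_sum_smul I _ Λm O).symm
    have Q2 : ∑ i ∈ I, ((w i : ℝ) : ℂ) • ∑ k ∈ s, (Hi i * fermionEmbed (PolySite.incl hΛ) (B k) -
          fermionEmbed (PolySite.incl hΛ) (B k) * Hi i) =
        ∑ k ∈ s, (Φb.localHamiltonian Λ' * fermionEmbed (PolySite.incl hΛ) (B k) -
          fermionEmbed (PolySite.incl hΛ) (B k) * Φb.localHamiltonian Λ') := by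
      simp_rw [Finset.smul_sum]
      rw [Finset.sum_comm]
      refine Finset.sum_congr rfl fun k _ => ?_
      have e1 : ∀ i, ((w i : ℝ) : ℂ) • (Hi i * fermionEmbed (PolySite.incl hΛ) (B k)) =
          (((w i : ℝ) : ℂ) • Hi i) * fermionEmbed (PolySite.incl hΛ) (B k) := fun i =>
        (smul_mul_assoc _ _ _).symm
      have e2 : ∀ i, ((w i : ℝ) : ℂ) • (fermionEmbed (PolySite.incl hΛ) (B k) * Hi i) =
          fermionEmbed (PolySite.incl hΛ) (B k) * (((w i : ℝ) : ℂ) • Hi i) := fun i =>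
        (mul_smul_comm _ _ _).symm
      simp_rw [smul_sub, e1, e2]
      rw [Finset.sum_sub_distrib, ← Finset.sum_mul, ← Finset.mul_sum, ← hH']
    have Q3 : ∑ i ∈ I, ((w i : ℝ) : ℂ) • ∑ l ∈ tt, (fermionEmbed (PolySite.incl (hsh l))
          (fermionEmbed (PolySite.d4Emb (γ l) (wv l) Λ) (Y i l)) - fermionEmbed (PolySite.incl hΛ) (Y i l)) =
        ∑ l ∈ tt, (fermionEmbed (PolySite.incl (hsh l))
          (fermionEmbed (PolySite.d4Emb (γ l) (wv l) Λ) (∑ i ∈ I, ((w i : ℝ) : ℂ) • Y i l)) -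
          fermionEmbed (PolySite.incl hΛ) (∑ i ∈ I, ((w i : ℝ) : ℂ) • Y i l)) := by
      simp_rw [Finset.smul_sum]
      rw [Finset.sum_comm]
      refine Finset.sum_congr rfl fun l _ => ?_
      simp_rw [smul_sub]
      rw [Finset.sum_sub_distrib, map_sum, map_sum, map_sum]
      congr 1
      · exact Finset.sum_congr rfl fun i _ => by rw [map_smul, map_smul]
      · exact Finset.sum_congr rfl fun i _ => by rw [map_smul]
    have Q4 : ∑ i ∈ I, ((w i : ℝ) : ℂ) • ∑ j ∈ uu, b i j • ladderWord (cw j) =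
        ∑ j ∈ uu, (∑ i ∈ I, ((w i : ℝ) : ℂ) * b i j) • ladderWord (cw j) := by
      simp_rw [Finset.smul_sum, smul_smul]
      rw [Finset.sum_comm]
      exact Finset.sum_congr rfl fun j _ => by rw [Finset.sum_smul]
    have Q5 : ∑ i ∈ I, ((w i : ℝ) : ℂ) • ∑ m' ∈ ah, ((dc i m' : ℝ) : ℂ) • ((V m')ᴴ - V m') =
        ∑ m' ∈ ah, (((∑ i ∈ I, w i * dc i m' : ℝ)) : ℂ) • ((V m')ᴴ - V m') := by
      simp_rw [Finset.smul_sum, smul_smul]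
      rw [Finset.sum_comm]
      refine Finset.sum_congr rfl fun m' _ => ?_
      rw [← Finset.sum_smul, Complex.ofReal_sum]
      simp_rw [Complex.ofReal_mul]
    have Q6 : ∑ i ∈ I, ((w i : ℝ) : ℂ) • ∑ k ∈ wd, a i k • ladderWord (word k) =
        ∑ k ∈ wd, (∑ i ∈ I, ((w i : ℝ) : ℂ) * a i k) • ladderWord (word k) := by
      simp_rw [Finset.smul_sum, smul_smul]
      rw [Finset.sum_comm]
      exact Finset.sum_congr rfl fun k _ => by rw [Finset.sum_smul]
    simp only [smul_add, Finset.sum_add_distrib]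
    rw [Q1, Q2, Q3, Q4, Q5, Q6]
  -- §C the combined identity, and the tree theorem at the barycentre
  have hs : ∑ i ∈ I, ((w i : ℝ) : ℂ) • (Xw - ((c i : ℝ) : ℂ) • (1 : FermionOp Λ') -
        ∑ σ : Fin 2, ((μ i σ : ℝ) : ℂ) • (nAt 0 hz σ - ((ν : ℝ) : ℂ) • (1 : FermionOp Λ')) -
        ((κ : ℝ) : ℂ) • (((u i : ℝ) : ℂ) • (1 : FermionOp Λ') - fermionEmbed (PolySite.incl h0) (Ei i))) =
      ∑ i ∈ I, ((w i : ℝ) : ℂ) • (gramForm (Λm i) O +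
        (∑ k ∈ s, (Hi i * fermionEmbed (PolySite.incl hΛ) (B k) -
            fermionEmbed (PolySite.incl hΛ) (B k) * Hi i) +
          ∑ l ∈ tt, (fermionEmbed (PolySite.incl (hsh l))
              (fermionEmbed (PolySite.d4Emb (γ l) (wv l) Λ) (Y i l)) -
            fermionEmbed (PolySite.incl hΛ) (Y i l)) +
          ∑ j ∈ uu, b i j • ladderWord (cw j)) +
        (∑ m' ∈ ah, ((dc i m' : ℝ) : ℂ) • ((V m')ᴴ - V m') + ∑ k ∈ wd, a i k • ladderWord (word k))) :=
    Finset.sum_congr rfl fun i hi => by rw [hcert i hi]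
  rw [hl, hr] at hs
  have h := hω.re_sum_expect_d4_ge_of_window_certificate_TT'_ineq t (∑ i ∈ I, w i * tp i) hUbar hn0
    hn2 hκ hu hΛ h8 h0 hz h1 hmul Xw (fun σ => ∑ i ∈ I, w i * μ i σ) ν hΛbar O s B tt γ hγS wv hsh
    (fun l => ∑ i ∈ I, ((w i : ℝ) : ℂ) • Y i l) uu (fun j => ∑ i ∈ I, ((w i : ℝ) : ℂ) * b i j) cw hcw
    ah (fun m' => ∑ i ∈ I, w i * dc i m') V wd (fun k => ∑ i ∈ I, ((w i : ℝ) : ℂ) * a i k) word hs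
    hLs hψ hψ1
  simpa using h

/-- **Box certificate, translation-only form** (all point-group labels trivial): under the
hypotheses of `…re_sum_expect_d4_ge_of_window_certificates_convexComb_TT'_ineq` with `γₗ = 1`, the
bound is on `Re ω_{Λ'}(X)` itself. [cite: WangEtAl2024, §III] -/
theorem InfVolFermionState.IsTorusLimitOf.re_expect_ge_of_window_certificates_convexComb_TT'_ineq
    (t : ℝ) {ι₀ : Type*} (I : Finset ι₀) (w : ι₀ → ℝ) (hw0 : ∀ i ∈ I, 0 ≤ w i)
    (hw1 : ∑ i ∈ I, w i = 1) (tp U u c : ι₀ → ℝ) (hU : ∀ i ∈ I, 0 ≤ U i)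
    {n : ℝ} (hn0 : 0 ≤ n) (hn2 : n < 2) {κ : ℝ} (hκ : 0 ≤ κ)
    (hu : ThermodynamicLimit.energyDensityTT' t (∑ i ∈ I, w i * tp i) (∑ i ∈ I, w i * U i) n ≤
      ∑ i ∈ I, w i * u i)
    {Λ Λ' : Finset (Site 2)} (hΛ : Λ ⊆ Λ') (h8 : thicken Λ 1 ⊆ Λ')
    (h0 : thicken ({0} : Finset (Site 2)) 1 ⊆ Λ') (hz : (0 : Site 2) ∈ Λ')
    (Xw : FermionOp Λ') (μ : ι₀ → Fin 2 → ℝ) (ν : ℝ)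
    {m : Type*} [Fintype m] [DecidableEq m] (Λm : ι₀ → Matrix m m ℂ)
    (hΛm : ∀ i ∈ I, (Λm i).PosSemidef) (O : m → FermionOp Λ')
    {κ' : Type*} (s : Finset κ') (B : κ' → FermionOp Λ)
    {ι : Type*} (tt : Finset ι) (γ : ι → DihedralGroup 4) (hγ1 : ∀ l ∈ tt, γ l = 1) (wv : ι → Site 2)
    (hsh : ∀ l, d4ShiftSet (γ l) (wv l) Λ ⊆ Λ') (Y : ι₀ → ι → FermionOp Λ)
    {ρ : Type*} (uu : Finset ρ) (b : ι₀ → ρ → ℂ) (cw : ρ → List (Orb (PolySite Λ') × Bool))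
    (hcw : ∀ j ∈ uu, ladderCharge (cw j) ≠ 0 ∨ ladderSpinCharge (cw j) ≠ 0)
    {δ : Type*} (ah : Finset δ) (dc : ι₀ → δ → ℝ) (V : δ → FermionOp Λ')
    {κ'' : Type*} (wd : Finset κ'') (a : ι₀ → κ'' → ℂ)
    (word : κ'' → List (Orb (PolySite Λ') × Bool))
    (hcert : ∀ i ∈ I, Xw - ((c i : ℝ) : ℂ) • (1 : FermionOp Λ') -
        ∑ σ : Fin 2, ((μ i σ : ℝ) : ℂ) • (nAt 0 hz σ - ((ν : ℝ) : ℂ) • (1 : FermionOp Λ')) -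
        ((κ : ℝ) : ℂ) • (((u i : ℝ) : ℂ) • (1 : FermionOp Λ') -
          fermionEmbed (PolySite.incl h0)
            ((hubbardTTPrimeFermionInteraction t (tp i) (U i)).meanEnergyObs 1)) =
      gramForm (Λm i) O +
        (∑ k ∈ s, ((hubbardTTPrimeFermionInteraction t (tp i) (U i)).localHamiltonian Λ' *
              fermionEmbed (PolySite.incl hΛ) (B k) -
            fermionEmbed (PolySite.incl hΛ) (B k) *
              (hubbardTTPrimeFermionInteraction t (tp i) (U i)).localHamiltonian Λ') +
          ∑ l ∈ tt, (fermionEmbed (PolySite.incl (hsh l))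
              (fermionEmbed (PolySite.d4Emb (γ l) (wv l) Λ) (Y i l)) -
            fermionEmbed (PolySite.incl hΛ) (Y i l)) +
          ∑ j ∈ uu, b i j • ladderWord (cw j)) +
        (∑ m' ∈ ah, ((dc i m' : ℝ) : ℂ) • ((V m')ᴴ - V m') + ∑ k ∈ wd, a i k • ladderWord (word k)))
    {Ls : ℕ → ℕ} (hLs : Tendsto Ls atTop atTop)
    {ψ : ∀ L, Fock (Orb (FermionTorus 2 L))}
    (hψ : ∀ j, IsGroundStateInSector
      (hubbardTorusTT' (Ls j) t (∑ i ∈ I, w i * tp i) (∑ i ∈ I, w i * U i))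
      (ThermodynamicLimit.rectN n (Ls j)) 0 (ψ (Ls j)))
    (hψ1 : ∀ j, star (ψ (Ls j)) ⬝ᵥ ψ (Ls j) = 1)
    {ω : InfVolFermionState 2} (hω : ω.IsTorusLimitOf ψ Ls) :
    ∑ i ∈ I, w i * c i - ∑ k ∈ wd, ‖∑ i ∈ I, ((w i : ℝ) : ℂ) * a i k‖ +
        (∑ σ : Fin 2, ∑ i ∈ I, w i * μ i σ) * (n / 2 - ν) ≤ (ω.expect Λ' Xw).re := by
  have h1 : (1 : DihedralGroup 4) ∈ ({1} : Finset (DihedralGroup 4)) := Finset.mem_singleton_self 1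
  have hmul : ∀ a ∈ ({1} : Finset (DihedralGroup 4)), ∀ b ∈ ({1} : Finset (DihedralGroup 4)),
      a * b ∈ ({1} : Finset (DihedralGroup 4)) := by
    intro a ha b hb
    rw [Finset.mem_singleton] at ha hb ⊢
    rw [ha, hb, mul_one]
  have hγS : ∀ l ∈ tt, γ l ∈ ({1} : Finset (DihedralGroup 4)) := fun l hl =>
    Finset.mem_singleton.2 (hγ1 l hl)
  have h := hω.re_sum_expect_d4_ge_of_window_certificates_convexComb_TT'_ineq t I w hw0 hw1 tp U u c
    hU hn0 hn2 hκ hu hΛ h8 h0 hz h1 hmul Xw μ ν Λm hΛm O s B tt γ hγS wv hsh Y uu b cw hcw ah dc V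
    wd a word hcert hLs hψ hψ1
  rwa [Finset.sum_singleton, Finset.card_singleton, Nat.cast_one, inv_one, one_mul,
    ω.expect_fermionEmbed_d4Emb_one_zero] at h

/-- **Weighted-corner form** (what a box evaluator uses): under the hypotheses of the
translation-only box certificate, the weighted mean of the CORNER bounds is a bound at the
barycentre, `Σ wᵢ (cᵢ − Σₖ ‖aᵢₖ‖ + (Σ_σ μᵢσ)(n/2 − ν)) ≤ Re ω_{Λ'}(X)` (`‖Σ wᵢ aᵢₖ‖ ≤ Σ wᵢ ‖aᵢₖ‖`);
in particular the smallest corner bound holds on the whole hull. [cite: WangEtAl2024, §III] -/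
theorem InfVolFermionState.IsTorusLimitOf.re_expect_ge_of_window_certificates_convexComb_TT'_ineq_weighted
    (t : ℝ) {ι₀ : Type*} (I : Finset ι₀) (w : ι₀ → ℝ) (hw0 : ∀ i ∈ I, 0 ≤ w i)
    (hw1 : ∑ i ∈ I, w i = 1) (tp U u c : ι₀ → ℝ) (hU : ∀ i ∈ I, 0 ≤ U i)
    {n : ℝ} (hn0 : 0 ≤ n) (hn2 : n < 2) {κ : ℝ} (hκ : 0 ≤ κ)
    (hu : ThermodynamicLimit.energyDensityTT' t (∑ i ∈ I, w i * tp i) (∑ i ∈ I, w i * U i) n ≤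
      ∑ i ∈ I, w i * u i)
    {Λ Λ' : Finset (Site 2)} (hΛ : Λ ⊆ Λ') (h8 : thicken Λ 1 ⊆ Λ')
    (h0 : thicken ({0} : Finset (Site 2)) 1 ⊆ Λ') (hz : (0 : Site 2) ∈ Λ')
    (Xw : FermionOp Λ') (μ : ι₀ → Fin 2 → ℝ) (ν : ℝ)
    {m : Type*} [Fintype m] [DecidableEq m] (Λm : ι₀ → Matrix m m ℂ)
    (hΛm : ∀ i ∈ I, (Λm i).PosSemidef) (O : m → FermionOp Λ')
    {κ' : Type*} (s : Finset κ') (B : κ' → FermionOp Λ)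
    {ι : Type*} (tt : Finset ι) (γ : ι → DihedralGroup 4) (hγ1 : ∀ l ∈ tt, γ l = 1) (wv : ι → Site 2)
    (hsh : ∀ l, d4ShiftSet (γ l) (wv l) Λ ⊆ Λ') (Y : ι₀ → ι → FermionOp Λ)
    {ρ : Type*} (uu : Finset ρ) (b : ι₀ → ρ → ℂ) (cw : ρ → List (Orb (PolySite Λ') × Bool))
    (hcw : ∀ j ∈ uu, ladderCharge (cw j) ≠ 0 ∨ ladderSpinCharge (cw j) ≠ 0)
    {δ : Type*} (ah : Finset δ) (dc : ι₀ → δ → ℝ) (V : δ → FermionOp Λ')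
    {κ'' : Type*} (wd : Finset κ'') (a : ι₀ → κ'' → ℂ)
    (word : κ'' → List (Orb (PolySite Λ') × Bool))
    (hcert : ∀ i ∈ I, Xw - ((c i : ℝ) : ℂ) • (1 : FermionOp Λ') -
        ∑ σ : Fin 2, ((μ i σ : ℝ) : ℂ) • (nAt 0 hz σ - ((ν : ℝ) : ℂ) • (1 : FermionOp Λ')) -
        ((κ : ℝ) : ℂ) • (((u i : ℝ) : ℂ) • (1 : FermionOp Λ') -
          fermionEmbed (PolySite.incl h0)
            ((hubbardTTPrimeFermionInteraction t (tp i) (U i)).meanEnergyObs 1)) =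
      gramForm (Λm i) O +
        (∑ k ∈ s, ((hubbardTTPrimeFermionInteraction t (tp i) (U i)).localHamiltonian Λ' *
              fermionEmbed (PolySite.incl hΛ) (B k) -
            fermionEmbed (PolySite.incl hΛ) (B k) *
              (hubbardTTPrimeFermionInteraction t (tp i) (U i)).localHamiltonian Λ') +
          ∑ l ∈ tt, (fermionEmbed (PolySite.incl (hsh l))
              (fermionEmbed (PolySite.d4Emb (γ l) (wv l) Λ) (Y i l)) -
            fermionEmbed (PolySite.incl hΛ) (Y i l)) +
          ∑ j ∈ uu, b i j • ladderWord (cw j)) +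
        (∑ m' ∈ ah, ((dc i m' : ℝ) : ℂ) • ((V m')ᴴ - V m') + ∑ k ∈ wd, a i k • ladderWord (word k)))
    {Ls : ℕ → ℕ} (hLs : Tendsto Ls atTop atTop)
    {ψ : ∀ L, Fock (Orb (FermionTorus 2 L))}
    (hψ : ∀ j, IsGroundStateInSector
      (hubbardTorusTT' (Ls j) t (∑ i ∈ I, w i * tp i) (∑ i ∈ I, w i * U i))
      (ThermodynamicLimit.rectN n (Ls j)) 0 (ψ (Ls j)))
    (hψ1 : ∀ j, star (ψ (Ls j)) ⬝ᵥ ψ (Ls j) = 1)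
    {ω : InfVolFermionState 2} (hω : ω.IsTorusLimitOf ψ Ls) :
    ∑ i ∈ I, w i * (c i - ∑ k ∈ wd, ‖a i k‖ + (∑ σ : Fin 2, μ i σ) * (n / 2 - ν)) ≤
      (ω.expect Λ' Xw).re := by
  have h := hω.re_expect_ge_of_window_certificates_convexComb_TT'_ineq t I w hw0 hw1 tp U u c hU hn0
    hn2 hκ hu hΛ h8 h0 hz Xw μ ν Λm hΛm O s B tt γ hγ1 wv hsh Y uu b cw hcw ah dc V wd a word hcert
    hLs hψ hψ1
  -- `‖Σ w a‖ ≤ Σ w ‖a‖`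
  have htri : ∑ k ∈ wd, ‖∑ i ∈ I, ((w i : ℝ) : ℂ) * a i k‖ ≤
      ∑ k ∈ wd, ∑ i ∈ I, w i * ‖a i k‖ := by
    refine Finset.sum_le_sum fun k _ => (norm_sum_le _ _).trans (Finset.sum_le_sum fun i hi => ?_)
    rw [norm_mul, Complex.norm_real, Real.norm_of_nonneg (hw0 i hi)]
  -- rearrange the weighted corner bounds
  have hre : ∑ i ∈ I, w i * (c i - ∑ k ∈ wd, ‖a i k‖ + (∑ σ : Fin 2, μ i σ) * (n / 2 - ν)) =
      ∑ i ∈ I, w i * c i - ∑ k ∈ wd, ∑ i ∈ I, w i * ‖a i k‖ +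
        (∑ σ : Fin 2, ∑ i ∈ I, w i * μ i σ) * (n / 2 - ν) := by
    have e1 : ∀ i, w i * (c i - ∑ k ∈ wd, ‖a i k‖ + (∑ σ : Fin 2, μ i σ) * (n / 2 - ν)) =
        w i * c i - ∑ k ∈ wd, w i * ‖a i k‖ + ∑ σ : Fin 2, w i * μ i σ * (n / 2 - ν) := by
      intro i
      rw [mul_add, mul_sub, Finset.mul_sum, Finset.sum_mul, Finset.mul_sum]
      simp_rw [mul_assoc]
    simp_rw [e1]
    rw [Finset.sum_add_distrib, Finset.sum_sub_distrib, Finset.sum_comm (s := I) (t := wd)]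
    congr 1
    rw [Finset.sum_mul, Finset.sum_comm]
    exact Finset.sum_congr rfl fun σ _ => by rw [Finset.sum_mul]
  rw [hre]
  linarith


/-- **Box certificate at a prescribed target `(t', U')`** (the calling convention of the crew's box
evaluator: the engine supplies the target and the two barycentre identities `Σ wᵢ t'ᵢ = t'`,
`Σ wᵢ Uᵢ = U'`): translation-only form. [cite: WangEtAl2024, §III] -/
theorem InfVolFermionState.IsTorusLimitOf.re_expect_ge_of_window_certificates_convexComb_TT'_ineq_at
    (t t' U' : ℝ) {ι₀ : Type*} (I : Finset ι₀) (w : ι₀ → ℝ) (hw0 : ∀ i ∈ I, 0 ≤ w i)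
    (hw1 : ∑ i ∈ I, w i = 1) (tp U u c : ι₀ → ℝ) (hU : ∀ i ∈ I, 0 ≤ U i)
    (htp : ∑ i ∈ I, w i * tp i = t') (hUU : ∑ i ∈ I, w i * U i = U')
    {n : ℝ} (hn0 : 0 ≤ n) (hn2 : n < 2) {κ : ℝ} (hκ : 0 ≤ κ)
    (hu : ThermodynamicLimit.energyDensityTT' t t' U' n ≤ ∑ i ∈ I, w i * u i)
    {Λ Λ' : Finset (Site 2)} (hΛ : Λ ⊆ Λ') (h8 : thicken Λ 1 ⊆ Λ')
    (h0 : thicken ({0} : Finset (Site 2)) 1 ⊆ Λ') (hz : (0 : Site 2) ∈ Λ')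
    (Xw : FermionOp Λ') (μ : ι₀ → Fin 2 → ℝ) (ν : ℝ)
    {m : Type*} [Fintype m] [DecidableEq m] (Λm : ι₀ → Matrix m m ℂ)
    (hΛm : ∀ i ∈ I, (Λm i).PosSemidef) (O : m → FermionOp Λ')
    {κ' : Type*} (s : Finset κ') (B : κ' → FermionOp Λ)
    {ι : Type*} (tt : Finset ι) (γ : ι → DihedralGroup 4) (hγ1 : ∀ l ∈ tt, γ l = 1) (wv : ι → Site 2)
    (hsh : ∀ l, d4ShiftSet (γ l) (wv l) Λ ⊆ Λ') (Y : ι₀ → ι → FermionOp Λ)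
    {ρ : Type*} (uu : Finset ρ) (b : ι₀ → ρ → ℂ) (cw : ρ → List (Orb (PolySite Λ') × Bool))
    (hcw : ∀ j ∈ uu, ladderCharge (cw j) ≠ 0 ∨ ladderSpinCharge (cw j) ≠ 0)
    {δ : Type*} (ah : Finset δ) (dc : ι₀ → δ → ℝ) (V : δ → FermionOp Λ')
    {κ'' : Type*} (wd : Finset κ'') (a : ι₀ → κ'' → ℂ)
    (word : κ'' → List (Orb (PolySite Λ') × Bool))
    (hcert : ∀ i ∈ I, Xw - ((c i : ℝ) : ℂ) • (1 : FermionOp Λ') -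
        ∑ σ : Fin 2, ((μ i σ : ℝ) : ℂ) • (nAt 0 hz σ - ((ν : ℝ) : ℂ) • (1 : FermionOp Λ')) -
        ((κ : ℝ) : ℂ) • (((u i : ℝ) : ℂ) • (1 : FermionOp Λ') -
          fermionEmbed (PolySite.incl h0)
            ((hubbardTTPrimeFermionInteraction t (tp i) (U i)).meanEnergyObs 1)) =
      gramForm (Λm i) O +
        (∑ k ∈ s, ((hubbardTTPrimeFermionInteraction t (tp i) (U i)).localHamiltonian Λ' *
              fermionEmbed (PolySite.incl hΛ) (B k) -
            fermionEmbed (PolySite.incl hΛ) (B k) *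
              (hubbardTTPrimeFermionInteraction t (tp i) (U i)).localHamiltonian Λ') +
          ∑ l ∈ tt, (fermionEmbed (PolySite.incl (hsh l))
              (fermionEmbed (PolySite.d4Emb (γ l) (wv l) Λ) (Y i l)) -
            fermionEmbed (PolySite.incl hΛ) (Y i l)) +
          ∑ j ∈ uu, b i j • ladderWord (cw j)) +
        (∑ m' ∈ ah, ((dc i m' : ℝ) : ℂ) • ((V m')ᴴ - V m') + ∑ k ∈ wd, a i k • ladderWord (word k)))
    {Ls : ℕ → ℕ} (hLs : Tendsto Ls atTop atTop)
    {ψ : ∀ L, Fock (Orb (FermionTorus 2 L))}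
    (hψ : ∀ j, IsGroundStateInSector (hubbardTorusTT' (Ls j) t t' U')
      (ThermodynamicLimit.rectN n (Ls j)) 0 (ψ (Ls j)))
    (hψ1 : ∀ j, star (ψ (Ls j)) ⬝ᵥ ψ (Ls j) = 1)
    {ω : InfVolFermionState 2} (hω : ω.IsTorusLimitOf ψ Ls) :
    ∑ i ∈ I, w i * c i - ∑ k ∈ wd, ‖∑ i ∈ I, ((w i : ℝ) : ℂ) * a i k‖ +
        (∑ σ : Fin 2, ∑ i ∈ I, w i * μ i σ) * (n / 2 - ν) ≤ (ω.expect Λ' Xw).re := by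
  subst htp hUU
  exact hω.re_expect_ge_of_window_certificates_convexComb_TT'_ineq t I w hw0 hw1 tp U u c hU hn0 hn2
    hκ hu hΛ h8 h0 hz Xw μ ν Λm hΛm O s B tt γ hγ1 wv hsh Y uu b cw hcw ah dc V wd a word hcert hLs
    hψ hψ1

/-- **Weighted-corner box certificate at a prescribed target `(t', U')`.** [cite: WangEtAl2024, §III] -/
theorem InfVolFermionState.IsTorusLimitOf.re_expect_ge_of_window_certificates_convexComb_TT'_ineq_weighted_at
    (t t' U' : ℝ) {ι₀ : Type*} (I : Finset ι₀) (w : ι₀ → ℝ) (hw0 : ∀ i ∈ I, 0 ≤ w i)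
    (hw1 : ∑ i ∈ I, w i = 1) (tp U u c : ι₀ → ℝ) (hU : ∀ i ∈ I, 0 ≤ U i)
    (htp : ∑ i ∈ I, w i * tp i = t') (hUU : ∑ i ∈ I, w i * U i = U')
    {n : ℝ} (hn0 : 0 ≤ n) (hn2 : n < 2) {κ : ℝ} (hκ : 0 ≤ κ)
    (hu : ThermodynamicLimit.energyDensityTT' t t' U' n ≤ ∑ i ∈ I, w i * u i)
    {Λ Λ' : Finset (Site 2)} (hΛ : Λ ⊆ Λ') (h8 : thicken Λ 1 ⊆ Λ')
    (h0 : thicken ({0} : Finset (Site 2)) 1 ⊆ Λ') (hz : (0 : Site 2) ∈ Λ')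
    (Xw : FermionOp Λ') (μ : ι₀ → Fin 2 → ℝ) (ν : ℝ)
    {m : Type*} [Fintype m] [DecidableEq m] (Λm : ι₀ → Matrix m m ℂ)
    (hΛm : ∀ i ∈ I, (Λm i).PosSemidef) (O : m → FermionOp Λ')
    {κ' : Type*} (s : Finset κ') (B : κ' → FermionOp Λ)
    {ι : Type*} (tt : Finset ι) (γ : ι → DihedralGroup 4) (hγ1 : ∀ l ∈ tt, γ l = 1) (wv : ι → Site 2)
    (hsh : ∀ l, d4ShiftSet (γ l) (wv l) Λ ⊆ Λ') (Y : ι₀ → ι → FermionOp Λ)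
    {ρ : Type*} (uu : Finset ρ) (b : ι₀ → ρ → ℂ) (cw : ρ → List (Orb (PolySite Λ') × Bool))
    (hcw : ∀ j ∈ uu, ladderCharge (cw j) ≠ 0 ∨ ladderSpinCharge (cw j) ≠ 0)
    {δ : Type*} (ah : Finset δ) (dc : ι₀ → δ → ℝ) (V : δ → FermionOp Λ')
    {κ'' : Type*} (wd : Finset κ'') (a : ι₀ → κ'' → ℂ)
    (word : κ'' → List (Orb (PolySite Λ') × Bool))
    (hcert : ∀ i ∈ I, Xw - ((c i : ℝ) : ℂ) • (1 : FermionOp Λ') -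
        ∑ σ : Fin 2, ((μ i σ : ℝ) : ℂ) • (nAt 0 hz σ - ((ν : ℝ) : ℂ) • (1 : FermionOp Λ')) -
        ((κ : ℝ) : ℂ) • (((u i : ℝ) : ℂ) • (1 : FermionOp Λ') -
          fermionEmbed (PolySite.incl h0)
            ((hubbardTTPrimeFermionInteraction t (tp i) (U i)).meanEnergyObs 1)) =
      gramForm (Λm i) O +
        (∑ k ∈ s, ((hubbardTTPrimeFermionInteraction t (tp i) (U i)).localHamiltonian Λ' *
              fermionEmbed (PolySite.incl hΛ) (B k) -
            fermionEmbed (PolySite.incl hΛ) (B k) *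
              (hubbardTTPrimeFermionInteraction t (tp i) (U i)).localHamiltonian Λ') +
          ∑ l ∈ tt, (fermionEmbed (PolySite.incl (hsh l))
              (fermionEmbed (PolySite.d4Emb (γ l) (wv l) Λ) (Y i l)) -
            fermionEmbed (PolySite.incl hΛ) (Y i l)) +
          ∑ j ∈ uu, b i j • ladderWord (cw j)) +
        (∑ m' ∈ ah, ((dc i m' : ℝ) : ℂ) • ((V m')ᴴ - V m') + ∑ k ∈ wd, a i k • ladderWord (word k)))
    {Ls : ℕ → ℕ} (hLs : Tendsto Ls atTop atTop)
    {ψ : ∀ L, Fock (Orb (FermionTorus 2 L))}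
    (hψ : ∀ j, IsGroundStateInSector (hubbardTorusTT' (Ls j) t t' U')
      (ThermodynamicLimit.rectN n (Ls j)) 0 (ψ (Ls j)))
    (hψ1 : ∀ j, star (ψ (Ls j)) ⬝ᵥ ψ (Ls j) = 1)
    {ω : InfVolFermionState 2} (hω : ω.IsTorusLimitOf ψ Ls) :
    ∑ i ∈ I, w i * (c i - ∑ k ∈ wd, ‖a i k‖ + (∑ σ : Fin 2, μ i σ) * (n / 2 - ν)) ≤
      (ω.expect Λ' Xw).re := by
  subst htp hUU
  exact hω.re_expect_ge_of_window_certificates_convexComb_TT'_ineq_weighted t I w hw0 hw1 tp U u c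
    hU hn0 hn2 hκ hu hΛ h8 h0 hz Xw μ ν Λm hΛm O s B tt γ hγ1 wv hsh Y uu b cw hcw ah dc V wd a word
    hcert hLs hψ hψ1

/-! ### §4 Cells with an extent in the density `n` (shared density multipliers) -/

/-- **Box certificate over a `(t', U, n)`-cell** (corners at densities `nn i` with `Σ wᵢ nnᵢ = n`,
SHARED density multipliers `μ` — the rows `μ_σ (n_σ − ν)` take the value `n/2`, which varies over an
`n`-box, so their multiplier must be common to the corners; everything else as in `…_weighted_at`):
the `w`-combination of the corners' OWN certified values
`Σ wᵢ (cᵢ − Σₖ ‖aᵢₖ‖ + (Σ_σ μ_σ)(nnᵢ/2 − ν))` bounds `Re ω_{Λ'}(X)` below for every torus-limit ground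
state at the target `(t', U', n)`. Proof: `…_weighted_at` with constant `μ` and
`Σ wᵢ (Σμ)(nnᵢ/2 − ν) = (Σμ)(n/2 − ν)`. (Statement typed by the crew's planner hubbard-fast-p1,
TARGET §3.4′ n-direction remark / referee F8 (3), `HOME/hubbard-fast-p1/lean/T4nBox.lean`.)
[cite: WangEtAl2024, §III] -/
theorem InfVolFermionState.IsTorusLimitOf.re_expect_ge_of_window_certificates_convexComb_TT'_ineq_weighted_at_nbox
    (t t' U' : ℝ) {ι₀ : Type*} (I : Finset ι₀) (w : ι₀ → ℝ) (hw0 : ∀ i ∈ I, 0 ≤ w i)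
    (hw1 : ∑ i ∈ I, w i = 1) (tp U u c nn : ι₀ → ℝ) (hU : ∀ i ∈ I, 0 ≤ U i)
    (htp : ∑ i ∈ I, w i * tp i = t') (hUU : ∑ i ∈ I, w i * U i = U')
    {n : ℝ} (hnn : ∑ i ∈ I, w i * nn i = n) (hn0 : 0 ≤ n) (hn2 : n < 2) {κ : ℝ} (hκ : 0 ≤ κ)
    (hu : ThermodynamicLimit.energyDensityTT' t t' U' n ≤ ∑ i ∈ I, w i * u i)
    {Λ Λ' : Finset (Site 2)} (hΛ : Λ ⊆ Λ') (h8 : thicken Λ 1 ⊆ Λ')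
    (h0 : thicken ({0} : Finset (Site 2)) 1 ⊆ Λ') (hz : (0 : Site 2) ∈ Λ')
    (Xw : FermionOp Λ') (μ : Fin 2 → ℝ) (ν : ℝ)
    {m : Type*} [Fintype m] [DecidableEq m] (Λm : ι₀ → Matrix m m ℂ)
    (hΛm : ∀ i ∈ I, (Λm i).PosSemidef) (O : m → FermionOp Λ')
    {κ' : Type*} (s : Finset κ') (B : κ' → FermionOp Λ)
    {ι : Type*} (tt : Finset ι) (γ : ι → DihedralGroup 4) (hγ1 : ∀ l ∈ tt, γ l = 1) (wv : ι → Site 2)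
    (hsh : ∀ l, d4ShiftSet (γ l) (wv l) Λ ⊆ Λ') (Y : ι₀ → ι → FermionOp Λ)
    {ρ : Type*} (uu : Finset ρ) (b : ι₀ → ρ → ℂ) (cw : ρ → List (Orb (PolySite Λ') × Bool))
    (hcw : ∀ j ∈ uu, ladderCharge (cw j) ≠ 0 ∨ ladderSpinCharge (cw j) ≠ 0)
    {δ : Type*} (ah : Finset δ) (dc : ι₀ → δ → ℝ) (V : δ → FermionOp Λ')
    {κ'' : Type*} (wd : Finset κ'') (a : ι₀ → κ'' → ℂ)
    (word : κ'' → List (Orb (PolySite Λ') × Bool))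
    (hcert : ∀ i ∈ I, Xw - ((c i : ℝ) : ℂ) • (1 : FermionOp Λ') -
        ∑ σ : Fin 2, ((μ σ : ℝ) : ℂ) • (nAt 0 hz σ - ((ν : ℝ) : ℂ) • (1 : FermionOp Λ')) -
        ((κ : ℝ) : ℂ) • (((u i : ℝ) : ℂ) • (1 : FermionOp Λ') -
          fermionEmbed (PolySite.incl h0)
            ((hubbardTTPrimeFermionInteraction t (tp i) (U i)).meanEnergyObs 1)) =
      gramForm (Λm i) O +
        (∑ k ∈ s, ((hubbardTTPrimeFermionInteraction t (tp i) (U i)).localHamiltonian Λ' *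
              fermionEmbed (PolySite.incl hΛ) (B k) -
            fermionEmbed (PolySite.incl hΛ) (B k) *
              (hubbardTTPrimeFermionInteraction t (tp i) (U i)).localHamiltonian Λ') +
          ∑ l ∈ tt, (fermionEmbed (PolySite.incl (hsh l))
              (fermionEmbed (PolySite.d4Emb (γ l) (wv l) Λ) (Y i l)) -
            fermionEmbed (PolySite.incl hΛ) (Y i l)) +
          ∑ j ∈ uu, b i j • ladderWord (cw j)) +
        (∑ m' ∈ ah, ((dc i m' : ℝ) : ℂ) • ((V m')ᴴ - V m') + ∑ k ∈ wd, a i k • ladderWord (word k)))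
    {Ls : ℕ → ℕ} (hLs : Tendsto Ls atTop atTop)
    {ψ : ∀ L, Fock (Orb (FermionTorus 2 L))}
    (hψ : ∀ j, IsGroundStateInSector (hubbardTorusTT' (Ls j) t t' U')
      (ThermodynamicLimit.rectN n (Ls j)) 0 (ψ (Ls j)))
    (hψ1 : ∀ j, star (ψ (Ls j)) ⬝ᵥ ψ (Ls j) = 1)
    {ω : InfVolFermionState 2} (hω : ω.IsTorusLimitOf ψ Ls) :
    ∑ i ∈ I, w i * (c i - ∑ k ∈ wd, ‖a i k‖ + (∑ σ : Fin 2, μ σ) * (nn i / 2 - ν)) ≤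
      (ω.expect Λ' Xw).re := by
  have h := hω.re_expect_ge_of_window_certificates_convexComb_TT'_ineq_weighted_at t t' U' I w hw0
    hw1 tp U u c hU htp hUU hn0 hn2 hκ hu hΛ h8 h0 hz Xw (fun _ => μ) ν Λm hΛm O s B tt γ hγ1 wv hsh
    Y uu b cw hcw ah dc V wd a word hcert hLs hψ hψ1
  have e1 : ∑ i ∈ I, w i * (c i - ∑ k ∈ wd, ‖a i k‖ + (∑ σ : Fin 2, μ σ) * (nn i / 2 - ν)) =
      ∑ i ∈ I, w i * (c i - ∑ k ∈ wd, ‖a i k‖) +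
        (∑ σ : Fin 2, μ σ) / 2 * ∑ i ∈ I, w i * nn i - (∑ σ : Fin 2, μ σ) * ν * ∑ i ∈ I, w i := by
    rw [Finset.mul_sum, Finset.mul_sum, ← Finset.sum_add_distrib, ← Finset.sum_sub_distrib]
    exact Finset.sum_congr rfl fun i _ => by ring
  have e2 : ∑ i ∈ I, w i * (c i - ∑ k ∈ wd, ‖a i k‖ + (∑ σ : Fin 2, μ σ) * (n / 2 - ν)) =
      ∑ i ∈ I, w i * (c i - ∑ k ∈ wd, ‖a i k‖) +
        (∑ σ : Fin 2, μ σ) / 2 * n * ∑ i ∈ I, w i - (∑ σ : Fin 2, μ σ) * ν * ∑ i ∈ I, w i := by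
    rw [Finset.mul_sum, Finset.mul_sum, ← Finset.sum_add_distrib, ← Finset.sum_sub_distrib]
    exact Finset.sum_congr rfl fun i _ => by ring
  have e : ∑ i ∈ I, w i * (c i - ∑ k ∈ wd, ‖a i k‖ + (∑ σ : Fin 2, μ σ) * (nn i / 2 - ν)) =
      ∑ i ∈ I, w i * (c i - ∑ k ∈ wd, ‖a i k‖ + (∑ σ : Fin 2, μ σ) * (n / 2 - ν)) := by
    rw [e1, e2, hnn, hw1]; ring
  rw [e]
  exact h

/-! ### §5 Free per-vertex cap values: the re-booked form (cap slack charged at the query point) -/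

/-- **Re-booked weighted-corner box certificate** (`fastlayer-box/2` with per-vertex cap VALUES, rule B6′
of the crew's BOX2-SPEC): as `…_weighted_at`, but the corner cap values `uᵢ` are arbitrary reals (each
corner solved under its own cap) and the barycentre hypothesis is `e(t,t',U',n) ≤ ū` for ANY certified
`ū`; the conclusion pays the cap re-booking `κ·(Σ wᵢuᵢ − ū)`:
`Σ wᵢ (cᵢ − Σₖ ‖aᵢₖ‖ + (Σ_σ μᵢσ)(n/2 − ν)) + κ(Σ wᵢ uᵢ − ū) ≤ Re ω_{Λ'}(X)`.
Proof: in the corner identity `hcert` the constants `(cᵢ, uᵢ)` enter only through `cᵢ + κuᵢ`, so it also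
holds with `(cᵢ + κ(uᵢ − ū), ū)`; apply `…_weighted_at` with these. (Statement typed by the crew's planner
hubbard-fast-p1 g2, ruling R-4 "T4r".) [cite: WangEtAl2024, §III]
[cite: Bertsekas1999NonlinearProgramming, Prop. 5.1.3] -/
theorem InfVolFermionState.IsTorusLimitOf.re_expect_ge_of_window_certificates_convexComb_TT'_ineq_weighted_at_rebook
    (t t' U' : ℝ) {ι₀ : Type*} (I : Finset ι₀) (w : ι₀ → ℝ) (hw0 : ∀ i ∈ I, 0 ≤ w i)
    (hw1 : ∑ i ∈ I, w i = 1) (tp U u c : ι₀ → ℝ) (hU : ∀ i ∈ I, 0 ≤ U i)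
    (htp : ∑ i ∈ I, w i * tp i = t') (hUU : ∑ i ∈ I, w i * U i = U')
    {n : ℝ} (hn0 : 0 ≤ n) (hn2 : n < 2) {κ : ℝ} (hκ : 0 ≤ κ) {ū : ℝ}
    (hu : ThermodynamicLimit.energyDensityTT' t t' U' n ≤ ū)
    {Λ Λ' : Finset (Site 2)} (hΛ : Λ ⊆ Λ') (h8 : thicken Λ 1 ⊆ Λ')
    (h0 : thicken ({0} : Finset (Site 2)) 1 ⊆ Λ') (hz : (0 : Site 2) ∈ Λ')
    (Xw : FermionOp Λ') (μ : ι₀ → Fin 2 → ℝ) (ν : ℝ)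
    {m : Type*} [Fintype m] [DecidableEq m] (Λm : ι₀ → Matrix m m ℂ)
    (hΛm : ∀ i ∈ I, (Λm i).PosSemidef) (O : m → FermionOp Λ')
    {κ' : Type*} (s : Finset κ') (B : κ' → FermionOp Λ)
    {ι : Type*} (tt : Finset ι) (γ : ι → DihedralGroup 4) (hγ1 : ∀ l ∈ tt, γ l = 1) (wv : ι → Site 2)
    (hsh : ∀ l, d4ShiftSet (γ l) (wv l) Λ ⊆ Λ') (Y : ι₀ → ι → FermionOp Λ)
    {ρ : Type*} (uu : Finset ρ) (b : ι₀ → ρ → ℂ) (cw : ρ → List (Orb (PolySite Λ') × Bool))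
    (hcw : ∀ j ∈ uu, ladderCharge (cw j) ≠ 0 ∨ ladderSpinCharge (cw j) ≠ 0)
    {δ : Type*} (ah : Finset δ) (dc : ι₀ → δ → ℝ) (V : δ → FermionOp Λ')
    {κ'' : Type*} (wd : Finset κ'') (a : ι₀ → κ'' → ℂ)
    (word : κ'' → List (Orb (PolySite Λ') × Bool))
    (hcert : ∀ i ∈ I, Xw - ((c i : ℝ) : ℂ) • (1 : FermionOp Λ') -
        ∑ σ : Fin 2, ((μ i σ : ℝ) : ℂ) • (nAt 0 hz σ - ((ν : ℝ) : ℂ) • (1 : FermionOp Λ')) -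
        ((κ : ℝ) : ℂ) • (((u i : ℝ) : ℂ) • (1 : FermionOp Λ') -
          fermionEmbed (PolySite.incl h0)
            ((hubbardTTPrimeFermionInteraction t (tp i) (U i)).meanEnergyObs 1)) =
      gramForm (Λm i) O +
        (∑ k ∈ s, ((hubbardTTPrimeFermionInteraction t (tp i) (U i)).localHamiltonian Λ' *
              fermionEmbed (PolySite.incl hΛ) (B k) -
            fermionEmbed (PolySite.incl hΛ) (B k) *
              (hubbardTTPrimeFermionInteraction t (tp i) (U i)).localHamiltonian Λ') +
          ∑ l ∈ tt, (fermionEmbed (PolySite.incl (hsh l))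
              (fermionEmbed (PolySite.d4Emb (γ l) (wv l) Λ) (Y i l)) -
            fermionEmbed (PolySite.incl hΛ) (Y i l)) +
          ∑ j ∈ uu, b i j • ladderWord (cw j)) +
        (∑ m' ∈ ah, ((dc i m' : ℝ) : ℂ) • ((V m')ᴴ - V m') + ∑ k ∈ wd, a i k • ladderWord (word k)))
    {Ls : ℕ → ℕ} (hLs : Tendsto Ls atTop atTop)
    {ψ : ∀ L, Fock (Orb (FermionTorus 2 L))}
    (hψ : ∀ j, IsGroundStateInSector (hubbardTorusTT' (Ls j) t t' U')
      (ThermodynamicLimit.rectN n (Ls j)) 0 (ψ (Ls j)))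
    (hψ1 : ∀ j, star (ψ (Ls j)) ⬝ᵥ ψ (Ls j) = 1)
    {ω : InfVolFermionState 2} (hω : ω.IsTorusLimitOf ψ Ls) :
    ∑ i ∈ I, w i * (c i - ∑ k ∈ wd, ‖a i k‖ + (∑ σ : Fin 2, μ i σ) * (n / 2 - ν)) +
        κ * (∑ i ∈ I, w i * u i - ū) ≤ (ω.expect Λ' Xw).re := by
  -- re-booked constants: `c' i = c i + κ (u i - ū)`, cap value `ū` at every corner
  have hu' : ThermodynamicLimit.energyDensityTT' t t' U' n ≤ ∑ i ∈ I, w i * ū := by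
    rw [← Finset.sum_mul, hw1, one_mul]; exact hu
  have hcert' : ∀ i ∈ I, Xw - ((c i + κ * (u i - ū) : ℝ) : ℂ) • (1 : FermionOp Λ') -
        ∑ σ : Fin 2, ((μ i σ : ℝ) : ℂ) • (nAt 0 hz σ - ((ν : ℝ) : ℂ) • (1 : FermionOp Λ')) -
        ((κ : ℝ) : ℂ) • (((ū : ℝ) : ℂ) • (1 : FermionOp Λ') -
          fermionEmbed (PolySite.incl h0)
            ((hubbardTTPrimeFermionInteraction t (tp i) (U i)).meanEnergyObs 1)) =
      gramForm (Λm i) O +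
        (∑ k ∈ s, ((hubbardTTPrimeFermionInteraction t (tp i) (U i)).localHamiltonian Λ' *
              fermionEmbed (PolySite.incl hΛ) (B k) -
            fermionEmbed (PolySite.incl hΛ) (B k) *
              (hubbardTTPrimeFermionInteraction t (tp i) (U i)).localHamiltonian Λ') +
          ∑ l ∈ tt, (fermionEmbed (PolySite.incl (hsh l))
              (fermionEmbed (PolySite.d4Emb (γ l) (wv l) Λ) (Y i l)) -
            fermionEmbed (PolySite.incl hΛ) (Y i l)) +
          ∑ j ∈ uu, b i j • ladderWord (cw j)) +
        (∑ m' ∈ ah, ((dc i m' : ℝ) : ℂ) • ((V m')ᴴ - V m') + ∑ k ∈ wd, a i k • ladderWord (word k)) := by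
    intro i hi
    rw [← hcert i hi]
    have hc : ((c i + κ * (u i - ū) : ℝ) : ℂ) = ((c i : ℝ) : ℂ) + ((κ : ℝ) : ℂ) * (((u i : ℝ) : ℂ) - ((ū : ℝ) : ℂ)) := by
      push_cast; ring
    rw [hc, add_smul, mul_smul, smul_sub, smul_sub, sub_smul, smul_sub]
    abel
  have h := hω.re_expect_ge_of_window_certificates_convexComb_TT'_ineq_weighted_at t t' U' I w hw0
    hw1 tp U (fun _ => ū) (fun i => c i + κ * (u i - ū)) hU htp hUU hn0 hn2 hκ hu' hΛ h8 h0 hz Xw μ ν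
    Λm hΛm O s B tt γ hγ1 wv hsh Y uu b cw hcw ah dc V wd a word hcert' hLs hψ hψ1
  have e : ∑ i ∈ I, w i * (c i + κ * (u i - ū) - ∑ k ∈ wd, ‖a i k‖ + (∑ σ : Fin 2, μ i σ) * (n / 2 - ν)) =
      ∑ i ∈ I, w i * (c i - ∑ k ∈ wd, ‖a i k‖ + (∑ σ : Fin 2, μ i σ) * (n / 2 - ν)) +
        κ * (∑ i ∈ I, w i * u i - ū) := by
    have : κ * (∑ i ∈ I, w i * u i - ū) = ∑ i ∈ I, w i * (κ * (u i - ū)) := by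
      rw [show ū = ∑ i ∈ I, w i * ū by rw [← Finset.sum_mul, hw1, one_mul], ← Finset.sum_sub_distrib,
        Finset.mul_sum]
      refine Finset.sum_congr rfl fun i _ => ?_
      rw [← Finset.sum_mul, hw1, one_mul]; ring
    rw [this, ← Finset.sum_add_distrib]
    exact Finset.sum_congr rfl fun i _ => by ring
  rw [← e]
  exact h

end Literature.MathematicalPhysics.QuantumLattice

end
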